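import Literature.NumberTheory.EllipticCurves.TwoDescentRankZeroSelmerFullTwoTorsion
import HarnessLib

/-!
# Complete `2`-descent, IV: bookkeeping of Selmer classes over `ℚ` — square-free kernels of components,
# bit expansions, the parity index at a prime, and the sign kernel

Generic tools for a complete `2`-descent on the cohomological `Sel⁽²⁾(E/ℚ)` of a curve with rational `2`-torsion
`e₁, e₂, e₃` (Silverman, *AEC*, Prop. X.1.4 / X.4.9), continuing `TwoDescentRankZeroSelmerFullTwoTorsion.lean`:

* §1 **Bits of products**: `qr_q`, `v_q mod 2` of a finite product of non-zero rationals is the sum of the bits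
  (`qrBit_prod`, `parityBit_prod`), and of `∏_{ℓ ∈ T} ℓ` for a set of primes `T ∌ q` resp. `∋ q`
  (`parityBit_prod_primes`).
* §2 **Square-free kernel of a Selmer component**: if `S` is a finite set of primes off which the root differences
  are units, every component `[a]` of a class `c ∈ Sel⁽²⁾(E/ℚ)` is `[g]` for a SQUARE-FREE INTEGER
  `g = ± ∏_{ℓ ∈ T} ℓ`, `T ⊆ S` (`exists_kernel_of_mem_selmerGroup`: Silverman's `Sel⁽²⁾ ⊆ ℚ(S,2)²`, tree
  `exists_subset_abs_eq_prod_mul_sq_of_mem_selmerGroup`), with `v_q(a) ≡ [q ∈ T]` for every prime `q` and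
  `qr_q(a) = qr_q(±1) + Σ_{ℓ ∈ T} qr_q(ℓ)` for `q ∉ T`.
* §3 **The parity index at a prime**: for a prime `p`, the classes of `Sel⁽²⁾` whose two components have EVEN
  `p`-valuation form the kernel `N_p` of the parity-pair character `Sel⁽²⁾ → (ℤ/2)²`, so
  `#Sel⁽²⁾ ≤ 4 · #N_p` (`natCard_selmerGroup_le_four_mul`), with EQUALITY when the parity pairs `(0,1)` and `(1,0)`
  occur (`natCard_selmerGroup_eq_four_mul`) — e.g. at a twisting prime, where they are the pairs of `κ(T₁)`, `κ(T₂)`.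
* §4 **The sign kernel has index `2`** when some Selmer class has a negative `T₂`-component (e.g. `κ(T₁)` for
  `e₁ < e₂`): `#Sel⁽²⁾ = 2 · #{c ∈ Sel⁽²⁾ : b > 0}` (`natCard_selmerGroup_eq_two_mul_sign_kernel`).

Theorems only; no named fact. Cell `bsd-f1-sign2` (LEAD gk2-p1), toward LINE 49 stub D0≤2 (crux R″
`RankOneTwoTorsionResidualAtTwo`).

## References

* [SilvermanAEC2009] J. H. Silverman, *The Arithmetic of Elliptic Curves*, 2nd ed., GTM 106, Springer 2009,
  Prop. X.1.4 (`Sel⁽²⁾ ⊆ K(S,2) × K(S,2)`), Thm. X.1.1(c), Prop. X.4.9.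
* [Kramer1981] K. Kramer, *Arithmetic of elliptic curves upon quadratic extension*, Trans. AMS 264 (1981), §1.
-/

noncomputable section

open scoped Classical

universe u

namespace Literature.NumberTheory.EllipticCurves.TwoDescentLocal

open Literature.NumberTheory.EllipticCurves.KramerTwoDescent

/-! ## §1 Bits of products -/

/-- `qr_q` of a finite product of non-zero rationals is the sum of the bits. [cite: SilvermanAEC2009, X.§1 (Example X.1.5)] -/
theorem qrBit_prod (q : ℕ) [Fact q.Prime] {ι : Type*} (s : Finset ι) (f : ι → ℚ) (hf : ∀ i ∈ s, f i ≠ 0) :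
    qrBit q (∏ i ∈ s, f i) = ∑ i ∈ s, qrBit q (f i) := by
  induction s using Finset.induction_on with
  | empty => rw [Finset.prod_empty, Finset.sum_empty, show (1 : ℚ) = 1 * 1 by norm_num, qrBit_mul_self]
  | insert a s ha ih =>
    have hfa : f a ≠ 0 := hf a (Finset.mem_insert_self a s)
    have hfs : ∀ i ∈ s, f i ≠ 0 := fun i hi => hf i (Finset.mem_insert_of_mem hi)
    rw [Finset.prod_insert ha, Finset.sum_insert ha, qrBit_mul q hfa (Finset.prod_ne_zero_iff.mpr hfs), ih hfs]

/-- `v_q mod 2` of a finite product of non-zero rationals is the sum of the bits. [cite: SilvermanAEC2009, X.§1 (Example X.1.5)] -/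
theorem parityBit_prod (q : ℕ) [Fact q.Prime] {ι : Type*} (s : Finset ι) (f : ι → ℚ) (hf : ∀ i ∈ s, f i ≠ 0) :
    parityBit q (∏ i ∈ s, f i) = ∑ i ∈ s, parityBit q (f i) := by
  induction s using Finset.induction_on with
  | empty => rw [Finset.prod_empty, Finset.sum_empty, parityBit, padicValRat.one, Int.cast_zero]
  | insert a s ha ih =>
    have hfa : f a ≠ 0 := hf a (Finset.mem_insert_self a s)
    have hfs : ∀ i ∈ s, f i ≠ 0 := fun i hi => hf i (Finset.mem_insert_of_mem hi)
    rw [Finset.prod_insert ha, Finset.sum_insert ha, parityBit_mul hfa (Finset.prod_ne_zero_iff.mpr hfs), ih hfs]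

/-- The parity bit at `q` of a product of distinct primes `∏_{ℓ ∈ T} ℓ` is `[q ∈ T]`.
[cite: SilvermanAEC2009, X.§1 (Example X.1.5)] -/
theorem parityBit_prod_primes {T : Finset ℕ} (hT : ∀ ℓ ∈ T, ℓ.Prime) (q : ℕ) [Fact q.Prime] :
    parityBit q (∏ ℓ ∈ T, (ℓ : ℚ)) = if q ∈ T then 1 else 0 := by
  rw [parityBit, padicValRat_prod_primes hT q]
  split_ifs <;> simp

/-- The sign bit of `±1 · (positive)`: `signBit (ε * x) = signBit ε` for `0 < x`. [folklore] -/
private theorem signBit_mul_pos {ε x : ℚ} (hε : ε ≠ 0) (hx : 0 < x) : signBit (ε * x) = signBit ε := by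
  rw [signBit_mul hε hx.ne', (signBit_eq_zero_iff hx.ne').mpr hx, add_zero]

end Literature.NumberTheory.EllipticCurves.TwoDescentLocal

namespace WeierstrassCurve

open Literature.NumberTheory.GaloisRepresentations Literature.NumberTheory.EllipticCurves Field
open WeierstrassCurve.Affine WeierstrassCurve.Affine.Point
open Literature.NumberTheory.EllipticCurves.TwoDescentLocal
open Literature.NumberTheory.EllipticCurves.KramerTwoDescent
open IsDedekindDomain NumberField Rat.HeightOneSpectrum

variable (W : WeierstrassCurve ℚ) [W.IsElliptic] {e₁ e₂ e₃ : ℚ}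

/-! ## §2 The square-free kernel of a Selmer component -/

/-- **Square-free kernel of a Selmer component** (Silverman X.1.4: `Sel⁽²⁾ ⊆ ℚ(S,2)²`). Let `S` be a finite set
of primes off which `e₁ - e₂`, `e₁ - e₃` are units, and `c ∈ Sel⁽²⁾(E/ℚ)` with `T₁`-component `[a]`. Then there are
`T ⊆ S` and a sign `ε = ±1` with: `[a] = [ε ∏_{ℓ∈T} ℓ]` in `ℚˣ/ℚˣ²`, `ε = 1 ↔ 0 < a`, `v_q(a) ≡ [q ∈ T] (mod 2)`
for every prime `q`, and `qr_q(a) = qr_q(ε) + Σ_{ℓ∈T} qr_q(ℓ)` for every prime `q ∉ T`. (For the `T₂`-component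
use `h.swap₁₂`.) [cite: SilvermanAEC2009, Prop. X.1.4, Thm. X.1.1(c)] -/
theorem exists_kernel_of_mem_selmerGroup (h : W.toAffine.SplitTwoTorsion e₁ e₂ e₃) (S : Finset ℕ)
    (hS : ∀ q ∈ S, q.Prime)
    (hgood : ∀ ℓ : ℕ, (hℓ : ℓ.Prime) → ℓ ∉ S → haveI : Fact ℓ.Prime := ⟨hℓ⟩;
      padicValRat ℓ (e₁ - e₂) = 0 ∧ padicValRat ℓ (e₁ - e₃) = 0)
    {c : galH1Torsion W 2} (hc : c ∈ selmerGroup W 2) (a : ℚˣ)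
    (ha : kummerEquiv ℚ 2 (W.twoTorsionCharH1 h c) = Additive.ofMul (QuotientGroup.mk a)) :
    ∃ T ⊆ S, ∃ ε : ℚ, (ε = 1 ∨ ε = -1) ∧ (ε = 1 ↔ 0 < (a : ℚ)) ∧
      ∃ hg : ε * ∏ ℓ ∈ T, (ℓ : ℚ) ≠ 0,
        (QuotientGroup.mk a : SqUnits ℚ) = QuotientGroup.mk (Units.mk0 _ hg) ∧
        (∀ (q : ℕ) [Fact q.Prime], parityBit q (a : ℚ) = if q ∈ T then 1 else 0) ∧
        (∀ (q : ℕ) [Fact q.Prime], q ∉ T → qrBit q (a : ℚ) = qrBit q ε + ∑ ℓ ∈ T, qrBit q (ℓ : ℚ)) := by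
  obtain ⟨T, hTS, r, hr0, habs⟩ := W.exists_subset_abs_eq_prod_mul_sq_of_mem_selmerGroup h S hS hgood hc a ha
  have hTp : ∀ ℓ ∈ T, ℓ.Prime := fun ℓ hℓ => hS ℓ (hTS hℓ)
  have hprod_pos : (0 : ℚ) < ∏ ℓ ∈ T, (ℓ : ℚ) := Finset.prod_pos fun ℓ hℓ => by exact_mod_cast (hTp ℓ hℓ).pos
  have hprod0 : ∀ ℓ ∈ T, (ℓ : ℚ) ≠ 0 := fun ℓ hℓ => by exact_mod_cast (hTp ℓ hℓ).ne_zero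
  -- the sign
  set ε : ℚ := if (0 : ℚ) < a then 1 else -1 with hε
  have hε1 : ε = 1 ∨ ε = -1 := by rw [hε]; split_ifs <;> simp
  have hε0 : ε ≠ 0 := by rcases hε1 with h1 | h1 <;> rw [h1] <;> norm_num
  have hεpos : ε = 1 ↔ 0 < (a : ℚ) := by
    rw [hε]; split_ifs with hlt
    · exact ⟨fun _ => hlt, fun _ => rfl⟩
    · exact ⟨fun h1 => absurd h1 (by norm_num), fun hlt' => absurd hlt' hlt⟩
  have haeq : (a : ℚ) = ε * (∏ ℓ ∈ T, (ℓ : ℚ)) * r ^ 2 := by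
    rw [hε]; split_ifs with hlt
    · rw [one_mul, ← habs, abs_of_pos hlt]
    · have hneg : (a : ℚ) < 0 := lt_of_le_of_ne (not_lt.mp hlt) a.ne_zero
      rw [← neg_neg (a : ℚ), ← abs_of_neg hneg, habs]; ring
  have hg : ε * ∏ ℓ ∈ T, (ℓ : ℚ) ≠ 0 := mul_ne_zero hε0 hprod_pos.ne'
  refine ⟨T, hTS, ε, hε1, hεpos, hg, ?_, ?_, ?_⟩
  · -- same square class
    rw [mk_eq_sqClass_coe, mk_eq_sqClass_coe, Units.val_mk0]
    refine sqClass_eq_sqClass_of_isSquare_mul a.ne_zero hg ⟨(ε * ∏ ℓ ∈ T, (ℓ : ℚ)) * r, ?_⟩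
    rw [haeq]; ring
  · -- parities
    intro q _
    rw [haeq, parityBit_mul (mul_ne_zero hε0 hprod_pos.ne') (pow_ne_zero 2 hr0), parityBit_mul hε0 hprod_pos.ne',
      parityBit_prod_primes hTp q]
    have hpε : parityBit q ε = 0 := by
      rcases hε1 with h1 | h1 <;> rw [h1, parityBit]
      · rw [padicValRat.one, Int.cast_zero]
      · rw [padicValRat.neg, padicValRat.one, Int.cast_zero]
    have hpr : parityBit q (r ^ 2) = 0 := parityBit_eq_zero_iff.mpr ⟨padicValRat q r, by rw [padicValRat.pow r]; ring⟩
    rw [hpε, hpr, zero_add, add_zero]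
  · -- residue bits at `q ∉ T`
    intro q _ hqT
    rw [haeq, qrBit_mul q (mul_ne_zero hε0 hprod_pos.ne') (pow_ne_zero 2 hr0), qrBit_sq, add_zero,
      qrBit_mul q hε0 hprod_pos.ne', qrBit_prod q T _ hprod0]

/-! ## §3 The parity index at a prime -/

/-- The parity-pair character at `p` on `Sel⁽²⁾(E/ℚ)`: `c ↦ (v_p(a), v_p(b)) (mod 2)` for components `([a],[b])`,
read through Kummer theory and `parityHom`, on representatives. [cite: SilvermanAEC2009, Prop. X.1.4] -/
theorem parityHom_kummerEquiv_eq_parityBit {a₁ a₂ a₃ : ℚ} (h : W.toAffine.SplitTwoTorsion a₁ a₂ a₃) (p : ℕ) [Fact p.Prime]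
    {c : galH1Torsion W 2} {a : ℚˣ} (ha : kummerEquiv ℚ 2 (W.twoTorsionCharH1 h c) = Additive.ofMul (QuotientGroup.mk a)) :
    parityHom p (kummerEquiv ℚ 2 (W.twoTorsionCharH1 h c)) = parityBit p (a : ℚ) := by
  rw [ha, mk_eq_sqClass_coe, parityHom_sqClass a.ne_zero]

/-- **`#Sel⁽²⁾ = #(parity image) · #(parity kernel)` at a prime `p`**: with
`N_p = {c ∈ Sel⁽²⁾ : v_p(a), v_p(b) even}` and `I_p ⊆ (ℤ/2)²` the set of parity pairs of Selmer classes,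
`#Sel⁽²⁾ = #I_p · #N_p`; in particular `#Sel⁽²⁾ ≤ 4 · #N_p`. [cite: SilvermanAEC2009, Prop. X.1.4, Prop. X.4.9] -/
theorem natCard_selmerGroup_le_four_mul (h : W.toAffine.SplitTwoTorsion e₁ e₂ e₃) (p : ℕ) [Fact p.Prime] :
    Nat.card (W.selmerGroup 2) ≤ 4 * Nat.card {c : galH1Torsion W 2 // c ∈ W.selmerGroup 2 ∧
      parityHom p (kummerEquiv ℚ 2 (W.twoTorsionCharH1 h c)) = 0 ∧
      parityHom p (kummerEquiv ℚ 2 (W.twoTorsionCharH1 h.swap₁₂ c)) = 0} := by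
  haveI : Finite (W.selmerGroup 2) := W.finite_selmerGroup_holds two_ne_zero
  -- the parity-pair character
  let f₁ : galH1Torsion W 2 →+ ZMod 2 := (parityHom p).comp ((kummerEquiv ℚ 2).toAddMonoidHom.comp (W.twoTorsionCharH1 h))
  let f₂ : galH1Torsion W 2 →+ ZMod 2 :=
    (parityHom p).comp ((kummerEquiv ℚ 2).toAddMonoidHom.comp (W.twoTorsionCharH1 h.swap₁₂))
  let π : W.selmerGroup 2 →+ ZMod 2 × ZMod 2 := (f₁.prod f₂).comp (W.selmerGroup 2).subtype
  have hcard := AddSubgroup.card_eq_card_quotient_mul_card_addSubgroup π.ker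
  have hq : Nat.card (W.selmerGroup 2 ⧸ π.ker) ≤ 4 := by
    rw [Nat.card_congr (QuotientAddGroup.quotientKerEquivRange π).toEquiv]
    have := Nat.card_le_card_of_injective (π.range.subtype) π.range.subtype_injective
    rwa [Nat.card_prod, Nat.card_zmod] at this
  have hker : Nat.card π.ker = Nat.card {c : galH1Torsion W 2 // c ∈ W.selmerGroup 2 ∧
      parityHom p (kummerEquiv ℚ 2 (W.twoTorsionCharH1 h c)) = 0 ∧
      parityHom p (kummerEquiv ℚ 2 (W.twoTorsionCharH1 h.swap₁₂ c)) = 0} := by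
    refine Nat.card_congr
      { toFun := fun x => ⟨x.1.1, x.1.2, ?_⟩
        invFun := fun y => ⟨⟨y.1, y.2.1⟩, ?_⟩
        left_inv := fun x => rfl
        right_inv := fun y => rfl }
    · have hx := x.2
      rw [AddMonoidHom.mem_ker] at hx
      exact Prod.mk_eq_zero.mp hx
    · rw [AddMonoidHom.mem_ker]
      exact Prod.mk_eq_zero.mpr y.2.2
  rw [hcard, hker]
  exact Nat.mul_le_mul_right _ hq

/-- **`#Sel⁽²⁾ = 4 · #N_p` when the parity pairs `(0,1)` and `(1,0)` occur** (then the parity-pair character is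
ONTO `(ℤ/2)²`) — e.g. at a twisting prime of a quadratic twist, where they are the pairs of `κ(T₁)`, `κ(T₂)`.
[cite: SilvermanAEC2009, Prop. X.1.4, Prop. X.4.9] -/
theorem natCard_selmerGroup_eq_four_mul (h : W.toAffine.SplitTwoTorsion e₁ e₂ e₃) (p : ℕ) [Fact p.Prime]
    {c₁ c₂ : galH1Torsion W 2} (hc₁ : c₁ ∈ W.selmerGroup 2) (hc₂ : c₂ ∈ W.selmerGroup 2) (a₁ b₁ a₂ b₂ : ℚˣ)
    (ha₁ : kummerEquiv ℚ 2 (W.twoTorsionCharH1 h c₁) = Additive.ofMul (QuotientGroup.mk a₁))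
    (hb₁ : kummerEquiv ℚ 2 (W.twoTorsionCharH1 h.swap₁₂ c₁) = Additive.ofMul (QuotientGroup.mk b₁))
    (ha₂ : kummerEquiv ℚ 2 (W.twoTorsionCharH1 h c₂) = Additive.ofMul (QuotientGroup.mk a₂))
    (hb₂ : kummerEquiv ℚ 2 (W.twoTorsionCharH1 h.swap₁₂ c₂) = Additive.ofMul (QuotientGroup.mk b₂))
    (h₁ : parityBit p (a₁ : ℚ) = 0 ∧ parityBit p (b₁ : ℚ) = 1) (h₂ : parityBit p (a₂ : ℚ) = 1 ∧ parityBit p (b₂ : ℚ) = 0) :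
    Nat.card (W.selmerGroup 2) = 4 * Nat.card {c : galH1Torsion W 2 // c ∈ W.selmerGroup 2 ∧
      parityHom p (kummerEquiv ℚ 2 (W.twoTorsionCharH1 h c)) = 0 ∧
      parityHom p (kummerEquiv ℚ 2 (W.twoTorsionCharH1 h.swap₁₂ c)) = 0} := by
  haveI : Finite (W.selmerGroup 2) := W.finite_selmerGroup_holds two_ne_zero
  let f₁ : galH1Torsion W 2 →+ ZMod 2 := (parityHom p).comp ((kummerEquiv ℚ 2).toAddMonoidHom.comp (W.twoTorsionCharH1 h))
  let f₂ : galH1Torsion W 2 →+ ZMod 2 :=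
    (parityHom p).comp ((kummerEquiv ℚ 2).toAddMonoidHom.comp (W.twoTorsionCharH1 h.swap₁₂))
  let π : W.selmerGroup 2 →+ ZMod 2 × ZMod 2 := (f₁.prod f₂).comp (W.selmerGroup 2).subtype
  have hπ₁ : π ⟨c₁, hc₁⟩ = (0, 1) := by
    show (f₁ c₁, f₂ c₁) = _
    simp only [f₁, f₂, AddMonoidHom.coe_comp, Function.comp_apply, AddEquiv.coe_toAddMonoidHom]
    rw [W.parityHom_kummerEquiv_eq_parityBit h p ha₁, W.parityHom_kummerEquiv_eq_parityBit h.swap₁₂ p hb₁, h₁.1, h₁.2]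
  have hπ₂ : π ⟨c₂, hc₂⟩ = (1, 0) := by
    show (f₁ c₂, f₂ c₂) = _
    simp only [f₁, f₂, AddMonoidHom.coe_comp, Function.comp_apply, AddEquiv.coe_toAddMonoidHom]
    rw [W.parityHom_kummerEquiv_eq_parityBit h p ha₂, W.parityHom_kummerEquiv_eq_parityBit h.swap₁₂ p hb₂, h₂.1, h₂.2]
  -- `π` is onto
  have hsurj : Function.Surjective π := by
    intro x
    obtain ⟨u, v⟩ := x
    have hu : u = 0 ∨ u = 1 := by revert u; decide
    have hv : v = 0 ∨ v = 1 := by revert v; decide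
    rcases hu with rfl | rfl <;> rcases hv with rfl | rfl
    · exact ⟨0, by rw [_root_.map_zero]; rfl⟩
    · exact ⟨⟨c₁, hc₁⟩, hπ₁⟩
    · exact ⟨⟨c₂, hc₂⟩, hπ₂⟩
    · exact ⟨⟨c₁, hc₁⟩ + ⟨c₂, hc₂⟩, by rw [map_add, hπ₁, hπ₂]; rfl⟩
  have hcard := AddSubgroup.card_eq_card_quotient_mul_card_addSubgroup π.ker
  have hq : Nat.card (W.selmerGroup 2 ⧸ π.ker) = 4 := by
    rw [Nat.card_congr (QuotientAddGroup.quotientKerEquivRange π).toEquiv, AddMonoidHom.range_eq_top.mpr hsurj,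
      AddSubgroup.card_top, Nat.card_prod, Nat.card_zmod]
  have hker : Nat.card π.ker = Nat.card {c : galH1Torsion W 2 // c ∈ W.selmerGroup 2 ∧
      parityHom p (kummerEquiv ℚ 2 (W.twoTorsionCharH1 h c)) = 0 ∧
      parityHom p (kummerEquiv ℚ 2 (W.twoTorsionCharH1 h.swap₁₂ c)) = 0} := by
    refine Nat.card_congr
      { toFun := fun x => ⟨x.1.1, x.1.2, ?_⟩
        invFun := fun y => ⟨⟨y.1, y.2.1⟩, ?_⟩
        left_inv := fun x => rfl
        right_inv := fun y => rfl }
    · have hx := x.2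
      rw [AddMonoidHom.mem_ker] at hx
      exact Prod.mk_eq_zero.mp hx
    · rw [AddMonoidHom.mem_ker]
      exact Prod.mk_eq_zero.mpr y.2.2
  rw [hcard, hker, hq]

/-! ## §4 The sign kernel has index `2` -/

/-- **`#Sel⁽²⁾ = 2 · #{c ∈ Sel⁽²⁾ : b > 0}` when some Selmer class has a NEGATIVE `T₂`-component** (e.g. `κ(T₁)`
when `e₁ < e₂`): the sign of the `T₂`-component is a character onto `ℤ/2`.
[cite: SilvermanAEC2009, Prop. X.1.4 (the place `∞`), Prop. X.4.9] -/
theorem natCard_selmerGroup_eq_two_mul_sign_kernel (h : W.toAffine.SplitTwoTorsion e₁ e₂ e₃)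
    {c₁ : galH1Torsion W 2} (hc₁ : c₁ ∈ W.selmerGroup 2) (b₁ : ℚˣ)
    (hb₁ : kummerEquiv ℚ 2 (W.twoTorsionCharH1 h.swap₁₂ c₁) = Additive.ofMul (QuotientGroup.mk b₁)) (hneg : (b₁ : ℚ) < 0) :
    Nat.card (W.selmerGroup 2) = 2 * Nat.card {c : galH1Torsion W 2 // c ∈ W.selmerGroup 2 ∧
      signHom (kummerEquiv ℚ 2 (W.twoTorsionCharH1 h.swap₁₂ c)) = 0} := by
  haveI : Finite (W.selmerGroup 2) := W.finite_selmerGroup_holds two_ne_zero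
  let σ : W.selmerGroup 2 →+ ZMod 2 :=
    (signHom.comp ((kummerEquiv ℚ 2).toAddMonoidHom.comp (W.twoTorsionCharH1 h.swap₁₂))).comp (W.selmerGroup 2).subtype
  have hσ₁ : σ ⟨c₁, hc₁⟩ = 1 := by
    show signHom (kummerEquiv ℚ 2 (W.twoTorsionCharH1 h.swap₁₂ c₁)) = 1
    rw [W.signHom_kummerEquiv_eq_signBit h hb₁, signBit, if_pos hneg]
  have hsurj : Function.Surjective σ := by
    intro u
    have hu : u = 0 ∨ u = 1 := by revert u; decide
    rcases hu with rfl | rfl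
    · exact ⟨0, by rw [_root_.map_zero]⟩
    · exact ⟨⟨c₁, hc₁⟩, hσ₁⟩
  have hcard := AddSubgroup.card_eq_card_quotient_mul_card_addSubgroup σ.ker
  have hq : Nat.card (W.selmerGroup 2 ⧸ σ.ker) = 2 := by
    rw [Nat.card_congr (QuotientAddGroup.quotientKerEquivRange σ).toEquiv, AddMonoidHom.range_eq_top.mpr hsurj,
      AddSubgroup.card_top, Nat.card_zmod]
  have hker : Nat.card σ.ker = Nat.card {c : galH1Torsion W 2 // c ∈ W.selmerGroup 2 ∧
      signHom (kummerEquiv ℚ 2 (W.twoTorsionCharH1 h.swap₁₂ c)) = 0} := by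
    refine Nat.card_congr
      { toFun := fun x => ⟨x.1.1, x.1.2, ?_⟩
        invFun := fun y => ⟨⟨y.1, y.2.1⟩, ?_⟩
        left_inv := fun x => rfl
        right_inv := fun y => rfl }
    · have hx := x.2
      rw [AddMonoidHom.mem_ker] at hx
      exact hx
    · rw [AddMonoidHom.mem_ker]
      exact y.2.2
  rw [hcard, hker, hq]

/-- **For a rank-zero curve with `Ш[2] = 0` and `e₁ < e₂` exactly TWO Selmer classes have a positive
`T₂`-component** (`#Sel⁽²⁾ = 4` and `κ(T₁) = ((e₁-e₂)(e₁-e₃), e₁-e₂)` has a negative one).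
[cite: SilvermanAEC2009, Prop. X.1.4, Thm. X.4.2] -/
theorem natCard_selmer_signBit_eq_zero_eq_two (h : W.toAffine.SplitTwoTorsion e₁ e₂ e₃) (h12 : e₁ < e₂)
    (hrank : W.mordellWeilRank = 0) (hsha : ∀ x ∈ W.sha, (2 : ℕ) • x = 0 → x = 0) :
    Nat.card {c : galH1Torsion W 2 // c ∈ W.selmerGroup 2 ∧ signHom (kummerEquiv ℚ 2 (W.twoTorsionCharH1 h.swap₁₂ c)) = 0} = 2 := by
  have he0 : e₁ - e₂ ≠ 0 := sub_ne_zero.mpr h.ne₁₂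
  have h4 := W.natCard_selmerGroup_two_eq_four h hrank hsha
  have h2 := W.natCard_selmerGroup_eq_two_mul_sign_kernel h
    (twoDescentClass_mem_selmerGroup_T₁ W h (Units.mk0 _ h.c_ne_zero) (Units.mk0 _ he0) rfl rfl) (Units.mk0 _ he0)
    (W.kummerEquiv_twoTorsionCharH1_swap_twoDescentClass h _ _) (by rw [Units.val_mk0]; exact sub_neg.mpr h12)
  omega

end WeierstrassCurve

end
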